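import Summits.QuantumFields.YangMills.Theorems.BalabanUVNodesN21SelectedThresholdsTransportLedgers
import Summits.QuantumFields.YangMills.Theorems.BalabanUVNodesN21SelectedThresholdsSanity

/-!
# YM-DAG node N21 (= NE7c) — ROW A‴ VACUITY GUARD: the binder package of `levelLedgers_of_selectedThresholds_of_transport` ∕ `shellWeightBound_geometric_of_transport`
# (module 20c) is JOINTLY INHABITED by an honest LINEAGE toy — one Markov kernel step, a two-piece partition of unity, a genuine tilt sandwich with `C = 2` — the
# transported pieces∕weights are PRODUCED by module 20b's `sum_lineageMass_le` ∕ `sum_lineageMass_eq`, and the selected-threshold knit FIRES with a positive weight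

Track A of `YM-PLAN.md` (cell `pub-ymgap`, HUMAN RULING D-0062), node **N21**; R134 fan-out seat `pub-ymgap-dag-n21-d` (s2), generation 5, module 20d (ROW A‴ §4 of
`LENS-nearmiss.md` v5.0).  THEOREMS ONLY: 0 `def`, 0 `sorry`, standard axioms; COUNT-NEUTRAL; `--supports` the K3‴ item `SpineGivenEndpointR13` (stmt-QuantumFields-19912) as a
helper.  Imports module 20c `BalabanUVNodesN21SelectedThresholdsTransportLedgers` (the junction under test; brings 20b's `sum_lineageMass_le` ∕ `sum_lineageMass_eq`) and
module 18c `BalabanUVNodesN21SelectedThresholdsSanity` (`shell_eq_Ico`; brings `T4ShellMeasureLevels.Toy`).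

WHY (referees' standing check A2, as 18c did for 18b).  Module 20c's theorems are implications with a long binder list — older-measurable state laws, tilted twins, ONE
sandwich constant, `ℝ≥0∞` pieces with `hpieceT`, weights with `htotT`, (R) facts, windows, rate; this file shows the list is JOINTLY SATISFIABLE by a NON-DEGENERATE instance
in which the NEW binders of ROW A‴ are not assumed but PRODUCED from a typed lineage structure, exactly as lens (t-n″) asks of NODE O's term object: the pieces and weights
ARE lineage masses through a Markov kernel (`Kernel.const ℝ (Measure.dirac ())`) with a two-piece partition of unity (`q ≡ ½` on `Bool`), so `hpieceT` = 20b's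
`sum_lineageMass_le` and `htotT` = 20b's `sum_lineageMass_eq` (with EQUALITY); the tilted state law is `c_t • Lebesgue|[0,1]` with `c_t = 2` for `t ≥ 0` and `½` for
`t < 0`, so the sandwich holds with `C = 2` and FAILS with `C = 1` (genuine); the pieces are POSITIVE at every admissible assignment (no flat witness); and the knit FIRES
with weight `8·(½)^K`.  One slot per comparison at the top level (window depth `0`, `ν̄ = 1`), windows `[½, 1]`, widths `ρ_j = (½)^j∕4`, `κ_min = ½`, `F̄ = 1`.

HONEST FRAMING (binding).  A toy (Lebesgue measure on `[0,1]`, a constant kernel, constant halves), NOT an instance of Bałaban's objects; it certifies joint satisfiability and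
non-degeneracy of a binder list, nothing else.  Nothing of Bałaban's asserted; NE7c NOT PRINTED and NOT PROVED; **N21 is NOT discharged**; typed 28∕28, discharged count
untouched; one finite four-torus programme at fixed `ε` — NOT ℝ⁴, NOT infinite volume, NOT OS, NOT a mass gap, NOT Clay.  No decl below carries a cite tag ([folklore]).
-/

set_option autoImplicit false

noncomputable section

open scoped BigOperators ENNReal NNReal
open MeasureTheory ProbabilityTheory Set

namespace Summit.QuantumFields.YangMills.Theorems.N21SelectedThresholdsTransportSanity

open Literature.MathematicalPhysics.QuantumFieldTheory.Balaban1983to89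
open T4IndicatorShell (ShellWeightBound)
open T4ShellMeasureLevels (LiveWindow)
open T4ShellMeasureLevels.Toy (S lvl liveWindow)
open N21SelectedThresholdsTransport (sum_lineageMass_le sum_lineageMass_eq)
open N21SelectedThresholdsTransportLedgers (shellWeightBound_geometric_of_transport)
open N21SelectedThresholdsSanity (shell_eq_Ico)

/-! ## §1 The toy state laws: `c • Lebesgue|[0,1]` -/

section Toy

/-- the tilted toy law applied to a measurable set. [folklore] -/
theorem toyTilt_apply (c : ℝ≥0) {E : Set ℝ} (hE : MeasurableSet E) :
    (c • (volume.restrict (Icc (0 : ℝ) 1))) E = (c : ℝ≥0∞) * volume (E ∩ Icc (0 : ℝ) 1) := by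
  rw [Measure.smul_apply, Measure.restrict_apply hE, ENNReal.smul_def, smul_eq_mul]

/-- its total mass is `c`. [folklore] -/
theorem toyTilt_univ (c : ℝ≥0) : (c • (volume.restrict (Icc (0 : ℝ) 1))) univ = (c : ℝ≥0∞) := by
  rw [toyTilt_apply c MeasurableSet.univ, univ_inter, Real.volume_Icc, sub_zero, ENNReal.ofReal_one, mul_one]

/-- **THE SANDWICH WITH `C = 2`** for a tilt scalar `½ ≤ c ≤ 2`: `c•μ ≤ 2•μ` and `μ ≤ 2•(c•μ)`. [folklore] -/
theorem toySandwich (c : ℝ≥0) (h1 : c ≤ 2) (h2 : 1 ≤ 2 * c) (μ : Measure ℝ) :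
    c • μ ≤ (2 : ℝ≥0∞) • μ ∧ μ ≤ (2 : ℝ≥0∞) • (c • μ) := by
  have hc1 : (c : ℝ≥0∞) ≤ 2 := by exact_mod_cast h1
  have hc2 : (1 : ℝ≥0∞) ≤ 2 * (c : ℝ≥0∞) := by exact_mod_cast h2
  constructor
  · refine Measure.le_iff'.2 fun s => ?_
    rw [Measure.smul_apply, Measure.smul_apply, ENNReal.smul_def, smul_eq_mul, smul_eq_mul]
    exact mul_le_mul_left hc1 _
  · refine Measure.le_iff'.2 fun s => ?_
    rw [Measure.smul_apply, Measure.smul_apply, ENNReal.smul_def, smul_eq_mul, smul_eq_mul, ← mul_assoc]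
    exact le_mul_of_one_le_left zero_le hc2

/-- **A LINEAGE MASS IN THE TOY**: through the constant kernel to the one-point space with the half-weight, the lineage mass of a measurable event `E` under `c • Lebesgue|[0,1]`
is `½ · c · |E ∩ [0,1]|`. [folklore] -/
theorem toyLineageMass (c : ℝ≥0) {E : Set ℝ} (hE : MeasurableSet E) :
    ∫⁻ x in E, ∫⁻ _y, (2 : ℝ≥0∞)⁻¹ ∂((Kernel.const ℝ (Measure.dirac ())) x) ∂(c • (volume.restrict (Icc (0 : ℝ) 1)))
      = 2⁻¹ * ((c : ℝ≥0∞) * volume (E ∩ Icc (0 : ℝ) 1)) := by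
  have hinner : ∀ x : ℝ, ∫⁻ _y, (2 : ℝ≥0∞)⁻¹ ∂((Kernel.const ℝ (Measure.dirac ())) x) = 2⁻¹ := fun x => by
    rw [Kernel.const_apply, lintegral_const, measure_univ, mul_one]
  simp_rw [hinner]
  rw [setLIntegral_const, toyTilt_apply c hE]

end Toy

/-! ## §2 The guard -/

/-- **ROW A‴'s BINDER PACKAGE IS INHABITED BY AN HONEST LINEAGE TOY AND THE TRANSPORT KNIT FIRES.**  There are assignment-indexed `t`-free state laws `ν₀` and tilted laws
`νt` on `ℝ` (one slot `()` per comparison at the top level; both runs read the same slot), a Markov kernel `κ` to the younger one-point space, a two-piece partition of unity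
`q` on `Bool` (two lineages = the two terms), `ℝ≥0∞` pieces `m` and weights `A′`, shell letters `sh` and an assignment `a` such that: (i) THE PIECES AND WEIGHTS ARE
TRANSPORTED MASSES — `Σ_p q p x y = 1`, `m K b t () τ = ∫⁻_{shell at b K} ∫⁻ q τ dκ dνt`, `A′ K b t τ = ∫⁻ ∫⁻ q τ dκ dνt`; (ii) the sandwich `νt ≤ 2•ν₀ ∧ ν₀ ≤ 2•νt`
holds everywhere and is GENUINE (`νt ≤ 1•ν₀` FAILS at `t = 0`); (iii) the pieces are POSITIVE at every admissible assignment and every `t` (no flat witness); (iv) every `a K j`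
is admissible and `ShellWeightBound 1 T (A′·(a·)).toReal (A′·(a·)).toReal (sh·(a·)) (sh·(a·)) (K ↦ 8·(½)^K)` — the output of module 20c's `shellWeightBound_geometric_of_transport`
on the toy with `hpieceT` := 20b's `sum_lineageMass_le` and `htotT` := 20b's `sum_lineageMass_eq`. [folklore] -/
theorem selectedThresholdsTransport_fires :
    ∃ (ν₀ : ℕ → (ℕ → ℝ) → Unit → Measure ℝ) (νt : ℕ → (ℕ → ℝ) → ℝ → Unit → Measure ℝ) (κ : Kernel ℝ Unit) (_ : IsMarkovKernel κ)
      (q : Bool → ℝ → Unit → ℝ≥0∞) (m : ℕ → (ℕ → ℝ) → ℝ → Unit → Bool → ℝ≥0∞) (A' : ℕ → (ℕ → ℝ) → ℝ → Bool → ℝ≥0∞)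
      (sh : ℕ → (ℕ → ℝ) → ℝ → Bool → ℝ) (a : ℕ → ℕ → ℝ),
      -- (i) lineage structure: a partition of unity, pieces and weights ARE the transported masses through the kernel against the tilted state law
      (∀ x y, ∑ p, q p x y = 1) ∧
      (∀ (K : ℕ) (b : ℕ → ℝ) (t : ℝ) (τ : Bool), m K b t () τ =
        ∫⁻ x in {x : ℝ | b K * (1 - (1 / 4 : ℝ) * (1 / 2 : ℝ) ^ K) ≤ x ∧ x < b K}, ∫⁻ y, q τ x y ∂(κ x) ∂(νt K b t ())) ∧
      (∀ (K : ℕ) (b : ℕ → ℝ) (t : ℝ) (τ : Bool), A' K b t τ = ∫⁻ x in univ, ∫⁻ y, q τ x y ∂(κ x) ∂(νt K b t ())) ∧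
      -- (ii) the sandwich with `C = 2`, GENUINE: `C = 1` fails at `t = 0`
      (∀ (K : ℕ) (b : ℕ → ℝ) (t : ℝ), νt K b t () ≤ (2 : ℝ≥0∞) • ν₀ K b () ∧ ν₀ K b () ≤ (2 : ℝ≥0∞) • νt K b t ()) ∧
      ¬ (νt 0 (fun _ => 1) 0 () ≤ (1 : ℝ≥0∞) • ν₀ 0 (fun _ => 1) ()) ∧
      -- (iii) non-degenerate: POSITIVE pieces at every admissible assignment
      (∀ (K : ℕ) (b : ℕ → ℝ) (t : ℝ) (τ : Bool), (∀ j, b j ∈ Icc ((1 - (1 / 2 : ℝ)) * 1) 1) → 0 < (m K b t () τ).toReal) ∧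
      -- (iv) the selection: admissible, and the transport knit FIRES with weight `8·(½)^K`
      (∀ K j, a K j ∈ Icc ((1 - (1 / 2 : ℝ)) * 1) 1) ∧
      ShellWeightBound 1 (fun _ => (Finset.univ : Finset Bool)) (fun K t τ => (A' K (a K) t τ).toReal) (fun K t τ => (A' K (a K) t τ).toReal)
        (fun K => sh K (a K)) (fun K => sh K (a K)) fun K => 8 * (1 / 2 : ℝ) ^ K := by
  classical
  -- the toy letters
  let ρ : ℕ → ℝ := fun j => (1 / 4 : ℝ) * (1 / 2 : ℝ) ^ j
  let c : ℝ → ℝ≥0 := fun t => if 0 ≤ t then 2 else 2⁻¹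
  let ν₀ : ℕ → (ℕ → ℝ) → Unit → Measure ℝ := fun _ _ _ => volume.restrict (Icc (0 : ℝ) 1)
  let νt : ℕ → (ℕ → ℝ) → ℝ → Unit → Measure ℝ := fun _ _ t _ => c t • (volume.restrict (Icc (0 : ℝ) 1))
  let κ : Kernel ℝ Unit := Kernel.const ℝ (Measure.dirac ())
  let q : Bool → ℝ → Unit → ℝ≥0∞ := fun _ _ _ => 2⁻¹
  let m : ℕ → (ℕ → ℝ) → ℝ → Unit → Bool → ℝ≥0∞ := fun K b t _ τ =>
    ∫⁻ x in {x : ℝ | b (lvl K ()) * (1 - ρ (lvl K ())) ≤ x ∧ x < b (lvl K ())}, ∫⁻ y, q τ x y ∂(κ x) ∂(νt K b t ())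
  let A' : ℕ → (ℕ → ℝ) → ℝ → Bool → ℝ≥0∞ := fun K b t τ => ∫⁻ x in univ, ∫⁻ y, q τ x y ∂(κ x) ∂(νt K b t ())
  let sh : ℕ → (ℕ → ℝ) → ℝ → Bool → ℝ := fun K b t τ => (m K b t () τ).toReal
  -- elementary facts about the letters
  have hρ0 : ∀ j, 0 < ρ j := fun j => by positivity
  have hρ4 : ∀ j, ρ j ≤ 1 / 4 := fun j => by
    show (1 / 4 : ℝ) * (1 / 2 : ℝ) ^ j ≤ 1 / 4
    have : (1 / 2 : ℝ) ^ j ≤ 1 := pow_le_one₀ (by norm_num) (by norm_num)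
    linarith
  have hc1 : ∀ t, c t ≤ 2 := fun t => by
    show (if 0 ≤ t then (2 : ℝ≥0) else 2⁻¹) ≤ 2
    split_ifs
    · exact le_rfl
    · rw [← NNReal.coe_le_coe]; push_cast; norm_num
  have hc2 : ∀ t, 1 ≤ 2 * c t := fun t => by
    show 1 ≤ 2 * (if 0 ≤ t then (2 : ℝ≥0) else 2⁻¹)
    split_ifs
    · rw [← NNReal.coe_le_coe]; push_cast; norm_num
    · rw [← NNReal.coe_le_coe]; push_cast; norm_num
  have hq1 : ∀ (x : ℝ) (y : Unit), ∑ p, q p x y = 1 := fun x y => by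
    rw [Fintype.sum_bool]
    exact ENNReal.inv_two_add_inv_two
  have hqm : ∀ p : Bool, Measurable (Function.uncurry (q p)) := fun _ => measurable_const
  have hfin0 : ∀ (K : ℕ) (b : ℕ → ℝ), IsFiniteMeasure (ν₀ K b ()) := fun K b => by
    show IsFiniteMeasure (volume.restrict (Icc (0 : ℝ) 1)); infer_instance
  have hfint : ∀ (K : ℕ) (b : ℕ → ℝ) (t : ℝ), IsFiniteMeasure (νt K b t ()) := fun K b t => by
    show IsFiniteMeasure (c t • (volume.restrict (Icc (0 : ℝ) 1))); infer_instance
  have hκ : IsMarkovKernel κ := by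
    show IsMarkovKernel (Kernel.const ℝ (Measure.dirac ())); infer_instance
  -- the transported pieces and totals (20b §A)
  have hshellm : ∀ (u r : ℝ), MeasurableSet {x : ℝ | u * (1 - r) ≤ x ∧ x < u} := fun u r => by
    rw [shell_eq_Ico]; exact measurableSet_Ico
  have hpieceT : ∀ (K : ℕ) (b : ℕ → ℝ) (t : ℝ),
      ∑ τ ∈ (Finset.univ : Finset Bool), m K b t () τ ≤ νt K b t () {x : ℝ | b (lvl K ()) * (1 - ρ (lvl K ())) ≤ x ∧ x < b (lvl K ())} :=
    fun K b t => sum_lineageMass_le (νt K b t ()) κ Finset.univ q hqm (fun x y => (hq1 x y).le) _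
  have htotT : ∀ (K : ℕ) (b : ℕ → ℝ) (t : ℝ), ∑ τ ∈ (Finset.univ : Finset Bool), A' K b t τ = νt K b t () univ :=
    fun K b t => sum_lineageMass_eq (νt K b t ()) κ Finset.univ q hqm hq1 _
  have hA'le : ∀ (K : ℕ) (b : ℕ → ℝ) (t : ℝ) (τ : Bool), A' K b t τ ≤ νt K b t () univ := fun K b t τ => by
    rw [← htotT K b t]
    exact Finset.single_le_sum (fun _ _ => zero_le) (Finset.mem_univ τ)
  have hA'fin : ∀ (K : ℕ) (b : ℕ → ℝ) (t : ℝ) (τ : Bool), A' K b t τ ≠ ⊤ := fun K b t τ =>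
    ne_top_of_le_ne_top (measure_ne_top _ _) (hA'le K b t τ)
  have hmle : ∀ (K : ℕ) (b : ℕ → ℝ) (t : ℝ) (τ : Bool), m K b t () τ ≤ A' K b t τ := fun K b t τ =>
    lintegral_mono_set (subset_univ _)
  -- the explicit value of a piece and its positivity at admissible assignments
  have hm_eq : ∀ (K : ℕ) (b : ℕ → ℝ) (t : ℝ) (τ : Bool), m K b t () τ =
      2⁻¹ * ((c t : ℝ≥0∞) * volume ({x : ℝ | b K * (1 - ρ K) ≤ x ∧ x < b K} ∩ Icc (0 : ℝ) 1)) := fun K b t τ =>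
    toyLineageMass (c t) (hshellm (b K) (ρ K))
  have hm_pos : ∀ (K : ℕ) (b : ℕ → ℝ) (t : ℝ) (τ : Bool), (∀ j, b j ∈ Icc ((1 - (1 / 2 : ℝ)) * 1) 1) →
      0 < (m K b t () τ).toReal := by
    intro K b t τ hb
    have hbK := hb K
    have hb0 : 0 ≤ b K := by linarith [hbK.1]
    have hsub : Ico (b K * (1 - ρ K)) (b K) ⊆ Icc (0 : ℝ) 1 := fun x hx =>
      ⟨le_trans (by nlinarith [hρ4 K, hρ0 K]) hx.1, le_trans hx.2.le hbK.2⟩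
    have hvol : volume ({x : ℝ | b K * (1 - ρ K) ≤ x ∧ x < b K} ∩ Icc (0 : ℝ) 1) = ENNReal.ofReal (b K * ρ K) := by
      rw [shell_eq_Ico, inter_eq_self_of_subset_left hsub, Real.volume_Ico]
      congr 1; ring
    have hprod : 0 < b K * ρ K := mul_pos (by linarith [hbK.1]) (hρ0 K)
    have hct0 : c t ≠ 0 := by
      intro h0
      have h := hc2 t
      rw [h0, mul_zero] at h
      exact absurd h (not_le.2 zero_lt_one)
    have hct : (c t : ℝ≥0∞) ≠ 0 := ENNReal.coe_ne_zero.2 hct0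
    rw [hm_eq K b t τ, hvol]
    refine ENNReal.toReal_pos ?_ ?_
    · exact mul_ne_zero (by norm_num) (mul_ne_zero hct (by rwa [Ne, ENNReal.ofReal_eq_zero, not_le]))
    · exact ENNReal.mul_ne_top (by norm_num) (ENNReal.mul_ne_top ENNReal.coe_ne_top ENNReal.ofReal_ne_top)
  -- (iv) 20c on the toy
  obtain ⟨a, hadm, hSW⟩ := shellWeightBound_geometric_of_transport (ι := Bool) (σ := Unit) (X := fun _ _ => ℝ)
    (SA := S) (SB := S) (lvl := lvl) (ν₀ := ν₀) (νt := νt) (w := fun _ _ x => x) (θ := fun _ => 1) (κ := fun _ => 1 / 2) (ρ := ρ) (Fbar := 1)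
    (l₀ := 1) (T := fun _ => (Finset.univ : Finset Bool)) (C := 2) (A' := A') (B' := A') (shA := sh) (shB := sh) (mA := m) (mB := m)
    (N₁ := 0) (νbar := 1) (κmin := 1 / 2) (c₁ := 1 / 4) (ϑ := 1 / 2)
    (fun _ _ => measurable_id) (fun _ => one_pos) (fun _ => ⟨by norm_num, by norm_num⟩)
    (fun j => ⟨(hρ0 j).le, by linarith [hρ4 j]⟩) (fun _ _ _ _ _ => rfl) zero_le_one
    (fun K m' => by
      have h : (((S K ∪ S K).filter fun s => lvl K s = m').card : ℕ) ≤ 1 :=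
        (Finset.card_le_card (Finset.filter_subset _ _)).trans (by simp [S])
      exact_mod_cast h)
    ENNReal.ofNat_ne_top (by norm_num)
    (fun K b _ t _ s _ => toySandwich (c t) (hc1 t) (hc2 t) _)
    (fun K b _ t _ τ _ => ⟨ENNReal.toReal_nonneg, ENNReal.toReal_mono (hA'fin K b t τ) (hmle K b t τ), by simp [S, sh]⟩)
    (fun K b _ t _ s _ => hpieceT K b t) (fun K b _ t _ s _ => htotT K b t)
    (fun K b _ t _ τ _ => ⟨ENNReal.toReal_nonneg, ENNReal.toReal_mono (hA'fin K b t τ) (hmle K b t τ), by simp [S, sh]⟩)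
    (fun K b _ t _ s _ => hpieceT K b t) (fun K b _ t _ s _ => htotT K b t)
    liveWindow liveWindow (by norm_num) (fun _ => le_rfl) (fun j => by linarith [hρ4 j])
    (by norm_num) (by norm_num) (fun _ => le_rfl)
  -- the weight constant is `8`
  have h8 : (2 * (((0 : ℕ) + 1 : ℝ) * 1 * ((2 : ℝ≥0∞).toReal / (2 : ℝ≥0∞)⁻¹.toReal * (2 * 1 / (1 / 2))) * (1 / 4) * (1 / 2 : ℝ)⁻¹ ^ 0)) = 8 := by
    rw [ENNReal.toReal_inv]; norm_num
  refine ⟨ν₀, νt, κ, hκ, q, m, A', sh, a, hq1, fun K b t τ => rfl, fun K b t τ => rfl, fun K b t => toySandwich (c t) (hc1 t) (hc2 t) _, ?_,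
    hm_pos, hadm, ?_⟩
  · -- (ii) `C = 1` fails at `t = 0`: `2·Lebesgue|[0,1] ≤ Lebesgue|[0,1]` is false on `univ`
    intro h
    have h1 := Measure.le_iff'.1 h univ
    rw [one_smul] at h1
    change ((c 0) • (volume.restrict (Icc (0 : ℝ) 1))) univ ≤ (volume.restrict (Icc (0 : ℝ) 1)) univ at h1
    rw [toyTilt_univ, Measure.restrict_apply_univ, Real.volume_Icc, sub_zero, ENNReal.ofReal_one] at h1
    have hc0 : c 0 = 2 := by show (if (0 : ℝ) ≤ 0 then (2 : ℝ≥0) else 2⁻¹) = 2; rw [if_pos le_rfl]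
    rw [hc0] at h1
    exact absurd h1 (by norm_num)
  · rw [h8] at hSW
    exact hSW

end Summit.QuantumFields.YangMills.Theorems.N21SelectedThresholdsTransportSanity

end
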